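import Literature.NumberTheory.Transcendental.KZProduct
import Summits.KontsevichZagierPeriods.KontsevichZagierPeriods.Theorems.HurwitzMicroSectorsNormalFormPrincipleDimOneAssembly

/-!
# `NormalFormPrinciple` (stmt-KontsevichZagierPeriods-3869), line `SketchIdeator1` —
# the leaf off the box in dimension one, V: both leaves of the line on the dimension-`≤ 1` subgroup

Pure proof file (lead seat c4; `--supports` the crux). The line's residual is the pair of
conjecture-grade stubs `stub_boxRigidity` (⟺ `KZ.PiLocalKernel` up to `KZ.PiCancellation`) and
`stub_piCancellation` (`= KZ.PiCancellation`). On the subgroup of `FormalRep` generated by the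
representations of KZ's rational shape of dimension `≤ 1` BOTH hold unconditionally
(`piLocalKernel_of_dim_le_one`, with exponent `N = 0`; `piCancellation_of_dim_le_one`): a vanishing
value there is already a relation (`mem_relations_of_eval_eq_zero_of_dim_le_one`, Baker), and
`[π]·c ∈ relations` forces `eval c = 0` by soundness (`eval ([π]·c) = π · eval c`, `π ≠ 0`).

Sources: M. Kontsevich, D. Zagier, *Periods* (2001), §1.2 Conjecture 1, §4.1; J. Ayoub, EMS Newsl. 91
(2014), Conj. 7. No definitions are introduced.
-/

noncomputable section

open MeasureTheory Set Finset
open Literature.NumberTheory.Transcendental Literature.NumberTheory.Transcendental.KZ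

namespace Summit.KontsevichZagierPeriods.HurwitzMicroSectors.NormalFormPrinciple.PiBox

namespace Dlog

/-- **`PiCancellation` on the dimension-`≤ 1` rational subgroup.** If `c` is a formal
`ℤ`-combination of representations of KZ's rational shape of dimensions `≤ 1` and `[π]·c` is a
relation, then `c` is a relation: `π · eval c = eval ([π]·c) = 0` by soundness, so `eval c = 0`, and
Conjecture 1 in dimension `≤ 1` (`mem_relations_of_eval_eq_zero_of_dim_le_one`) concludes. This is
the restriction of the registered stub `stub_piCancellation` (`= KZ.PiCancellation`, item
stmt-KontsevichZagierPeriods-0540) to that subgroup. [cite: KontsevichZagier2001, §4.1] -/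
theorem piCancellation_of_dim_le_one {c : FormalRep}
    (hc : c ∈ AddSubgroup.closure
      {y : FormalRep | ∃ (m : ℕ) (N : IntegralRep m), m ≤ 1 ∧ N.IsRational ∧ y = of N})
    (hπ : of piRep * c ∈ relations) : c ∈ relations :=
  mem_relations_of_eval_eq_zero_of_dim_le_one hc
    (eval_eq_zero_of_piRep_mul_mem_relations relations_le_ker_eval_holds hπ)

/-- **`PiLocalKernel` on the dimension-`≤ 1` rational subgroup**, with exponent `N = 0`: a formal
`ℤ`-combination of representations of KZ's rational shape of dimensions `≤ 1` with value `0` is a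
relation outright (no power of `[π]` needed). This is the restriction of `KZ.PiLocalKernel` (item
stmt-KontsevichZagierPeriods-0541, implied by the registered stub `stub_boxRigidity`) to that subgroup.
[cite: Ayoub2014, Conj. 7] -/
theorem piLocalKernel_of_dim_le_one {c : FormalRep}
    (hc : c ∈ AddSubgroup.closure
      {y : FormalRep | ∃ (m : ℕ) (N : IntegralRep m), m ≤ 1 ∧ N.IsRational ∧ y = of N})
    (hv : eval c = 0) : ∃ N : ℕ, (fun x => of piRep * x)^[N] c ∈ relations :=
  ⟨0, by simpa using mem_relations_of_eval_eq_zero_of_dim_le_one hc hv⟩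

/-- **No torsion in dimension `≤ 1`.** On the subgroup of `FormalRep` generated by the
representations of KZ's rational shape of dimensions `≤ 1`, the quotient by the Kontsevich–Zagier
relations is torsion-free: `k • c ∈ relations` with `k ≠ 0` forces `c ∈ relations` (soundness gives
`k · eval c = 0`, then Conjecture 1 in dimension `≤ 1`). This answers, for `d ≤ 1`, the recorded
failure mode of item stmt-KontsevichZagierPeriods-10622 ("fails iff `FormalRep ⧸ relations` has
torsion in `d ≤ 1`"). [cite: KontsevichZagier2001, §1.2 Conjecture 1] -/
theorem mem_relations_of_zsmul_mem_of_dim_le_one {c : FormalRep} {k : ℤ} (hk : k ≠ 0)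
    (hc : c ∈ AddSubgroup.closure
      {y : FormalRep | ∃ (m : ℕ) (N : IntegralRep m), m ≤ 1 ∧ N.IsRational ∧ y = of N})
    (hkc : k • c ∈ relations) : c ∈ relations := by
  refine mem_relations_of_eval_eq_zero_of_dim_le_one hc ?_
  have h := relations_le_ker_eval_holds hkc
  rw [AddMonoidHom.mem_ker, map_zsmul, zsmul_eq_mul, mul_eq_zero] at h
  exact h.resolve_left (Int.cast_ne_zero.mpr hk)

end Dlog

end Summit.KontsevichZagierPeriods.HurwitzMicroSectors.NormalFormPrinciple.PiBox
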